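import Summits.HodgeConjecture.HodgeConjecture.Theorems.NikulinTwinTransportHodgeIsometryAlgebraic
import Literature.AlgebraicGeometry.Surfaces.K3SurfaceBuskinLeaves
import HarnessLib

/-!
# Route NikulinTwinTransport · `HodgeIsometryAlgebraic` (stmt-HodgeConjecture-13675) from the four named leaves of Buskin's theorem

The item `HodgeIsometryAlgebraic` is, verbatim, the body of the named fact
`Literature.AlgebraicGeometry.Surfaces.Buskin2019_hodgeIsometry_algebraic` (Buskin 2019, Thm. 1.1;
`hodgeIsometryAlgebraic_iff_buskin`, `Iff.rfl`). The tree now proves that fact from FOUR NAMED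
LEAVES (`Surfaces/K3SurfaceBuskinLeaves`, `Buskin2019_hodgeIsometry_algebraic_holds_of`, assembling
`Buskin2019_hodgeIsometry_algebraic_of_reflective_of_cup` of `Surfaces/K3CorrespondenceComposition`):

* `Buskin2019_reflectiveHodgeIsometry_algebraic` — Buskin's Prop. 6.2 for reflective isometries
  (moduli of sheaves, twistor lines, hyperholomorphic transport);
* `cupProduct_mem_algebraicClasses_tripleProduct_surfaces` — `N²H⁴ ∪ N²H⁴ ⊆ N⁴H⁸` on triple
  products of smooth projective surfaces (Voisin II Prop. 9.20; the instance Lemma 6.3 consumes);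
* `Huybrechts_K3_periodSurjective_projective` — surjectivity of the period map, projective form;
* `Huybrechts_K3_marking_exists` — markings with projective period points.

This file records the item's closing form CONDITIONAL on exactly these four leaves (the gate's
`conditional-result`); the item closes the day the four `_holds` theorems land
(`hodgeIsometryAlgebraic_of_buskin (Buskin2019_hodgeIsometry_algebraic_holds_of …)`).
Prover seat prover-HodgeConjecture-route-HodgeConjecture-NikulinTwinTransport-0.
-/

namespace Summit.HodgeConjecture.HodgeConjecture.Theorems.NikulinTwinTransport

open Literature.AlgebraicGeometry.Surfaces

/-- **`HodgeIsometryAlgebraic` from the four named leaves of Buskin's Theorem 1.1**: Prop. 6.2 for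
reflective isometries, the multiplicativity of algebraic classes on triple products of surfaces,
the surjectivity of the period map and the existence of markings — through the tree's assembly
`Buskin2019_hodgeIsometry_algebraic_holds_of` and the by-name bridge `hodgeIsometryAlgebraic_of_buskin`.
CONDITIONAL on the four named facts (hypotheses); unconditional in everything else.
[cite: Buskin2019, Thm. 1.1 and §6.2 (Prop. 6.2, Lemma 6.3)] [cite: Huybrechts2019, Thm. 0.2]
[cite: VoisinHodgeII2003, §9.2.4 Prop. 9.20] -/
theorem hodgeIsometryAlgebraic_of_leaves
    (hrefl : Buskin2019_reflectiveHodgeIsometry_algebraic)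
    (hCUP : cupProduct_mem_algebraicClasses_tripleProduct_surfaces)
    (h : Huybrechts_K3_periodSurjective_projective) (hM : Huybrechts_K3_marking_exists) :
    Summit.HodgeConjecture.HodgeConjecture.Theses.NikulinTwinTransport.HodgeIsometryAlgebraic :=
  hodgeIsometryAlgebraic_of_buskin (Buskin2019_hodgeIsometry_algebraic_holds_of hrefl hCUP h hM)

end Summit.HodgeConjecture.HodgeConjecture.Theorems.NikulinTwinTransport
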